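import Mathlib
import Summits.Ventures.PercRepro2.SwOutAll
import Summits.Ventures.PercRepro2.SwOutArmFlip

/-!
# The junction split (blind cell PercRepro2, night-4 g11, 2026-08-25; proofs/NIGHT4-G11.md §2)

A JUNCTION is a vertex `u ≠ h, o` of the region without outside edges.  Its SPLIT graph
`splitEnds ends u` re-attaches every edge `e` at `u` from `u` to a private copy `Sum.inr e` of `u`
(vertex type `V ⊕ E`; the copies of the other edges are isolated).  A configuration is SPLIT-FINE
(`SplitFine`) when every copy of `u` lies in the split hull of `h` — equivalently every edge at `u`
is MATCHED (`Matched`: red iff its other end is in `C_R(h)`, blue iff in `C_B(h)`).  On split-fine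
configurations the split graph sees exactly the clusters, the edge sets `redEdges` / `blueEdges`,
the outside class and the side `Q` of the original graph (`cluster_eq_of_splitFine`,
`redEdges_eq_of_splitFine`, `mem_outClass_of_splitFine`, `mem_tgtU_of_splitFine`, …), and it is
core-free there (`coreFree_split_of_splitFine`).  This is what lets the arm principle of the split
graph serve the junction: its orbits are the FINE CUBES of the junction theorem (SwOutJunction).
-/

namespace Summit.Ventures.PercRepro2

namespace LocRows

open Hull

variable {V : Type*} {E : Type*} [Fintype E] [DecidableEq E]

open scoped Classical

/-! ## The split graph -/

section Split

variable (ends : E → Sym2 V) (u : V)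

/-- The split graph at `u`: every edge at `u` is re-attached to its own copy `Sum.inr e`. -/
noncomputable def splitEnds : E → Sym2 (V ⊕ E) :=
  fun e => if h : u ∈ ends e then s(Sum.inl (Sym2.Mem.other h), Sum.inr e) else (ends e).map Sum.inl

variable {ends u}

omit [Fintype E] [DecidableEq E] in
/-- The split incidence of an edge not at `u`: its endpoints, as copies `inl`. -/
lemma splitEnds_of_notMem {e : E} (he : u ∉ ends e) :
    splitEnds ends u e = (ends e).map Sum.inl := by
  simp [splitEnds, he]

omit [Fintype E] [DecidableEq E] in
/-- The split incidence of an edge at `u`: the copy `inl` of its other end and its own copy of `u`. -/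
lemma splitEnds_of_mem {e : E} (he : u ∈ ends e) :
    splitEnds ends u e = s(Sum.inl (Sym2.Mem.other he), Sum.inr e) := by
  simp [splitEnds, he]

omit [Fintype E] [DecidableEq E] in
/-- `ends e = s(u, other)` for an edge at `u`. -/
lemma ends_eq_other {e : E} (he : u ∈ ends e) : ends e = s(u, Sym2.Mem.other he) :=
  (Sym2.other_spec he).symm

omit [Fintype E] [DecidableEq E] in
/-- The other end of an edge `s(u, p)` at `u` is `p` (when `p ≠ u`). -/
lemma other_eq_of_ends {e : E} (he : u ∈ ends e) {p : V} (hp : ends e = s(u, p)) (hpu : p ≠ u) :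
    Sym2.Mem.other he = p := by
  have h1 : s(u, Sym2.Mem.other he) = s(u, p) := (Sym2.other_spec he).trans hp
  rw [Sym2.eq_iff] at h1
  rcases h1 with ⟨_, h⟩ | ⟨h, _⟩
  · exact h
  · exact absurd h.symm hpu

omit [Fintype E] [DecidableEq E] in
/-- Without a loop at `u`, the other end of an edge at `u` is not `u`. -/
lemma other_ne_u (hloop : ∀ e, ends e ≠ s(u, u)) {e : E} (he : u ∈ ends e) :
    Sym2.Mem.other he ≠ u := by
  intro h
  exact hloop e (by rw [ends_eq_other he, h])

omit [Fintype E] [DecidableEq E] in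
/-- The split incidence of an edge not at `u`, read off the endpoints. -/
lemma splitEnds_eq_of_notMem {e : E} {x y : V} (hxy : ends e = s(x, y)) (hx : x ≠ u) (hy : y ≠ u) :
    splitEnds ends u e = s(Sum.inl x, Sum.inl y) := by
  have he : u ∉ ends e := by
    rw [hxy, Sym2.mem_iff]; rintro (h | h)
    · exact hx h.symm
    · exact hy h.symm
  rw [splitEnds_of_notMem he, hxy, Sym2.map_mk]

omit [Fintype E] [DecidableEq E] in
/-- Every edge at `u` has an endpoint in `ends e` (trivial unpacking). -/
lemma exists_pair (z : Sym2 V) : ∃ x y : V, z = s(x, y) :=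
  Sym2.ind (fun x y => ⟨x, y, rfl⟩) z

omit [Fintype E] [DecidableEq E] in
/-- The copy `inl u` of `u` carries no edge in the split graph (no loop at `u`). -/
lemma inl_u_not_mem_splitEnds (hloop : ∀ e, ends e ≠ s(u, u)) (e : E) :
    Sum.inl u ∉ splitEnds ends u e := by
  by_cases he : u ∈ ends e
  · rw [splitEnds_of_mem he, Sym2.mem_iff]
    rintro (h | h)
    · exact other_ne_u hloop he (Sum.inl.inj h).symm
    · exact Sum.inl_ne_inr h
  · rw [splitEnds_of_notMem he, Sym2.mem_map]
    rintro ⟨a, ha, hae⟩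
    exact he ((Sum.inl.inj hae) ▸ ha)

omit [Fintype E] [DecidableEq E] in
/-- A copy `inr e` is an endpoint of the split edge `e'` only for `e' = e` at `u`. -/
lemma eq_of_inr_mem_splitEnds {e e' : E} (h : Sum.inr e ∈ splitEnds ends u e') :
    e' = e ∧ u ∈ ends e := by
  by_cases he : u ∈ ends e'
  · rw [splitEnds_of_mem he, Sym2.mem_iff] at h
    rcases h with h | h
    · exact absurd h (Sum.inr_ne_inl)
    · exact ⟨(Sum.inr.inj h).symm, (Sum.inr.inj h) ▸ he⟩
  · rw [splitEnds_of_notMem he, Sym2.mem_map] at h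
    obtain ⟨a, _, hae⟩ := h
    exact absurd hae Sum.inl_ne_inr

omit [Fintype E] [DecidableEq E] in
/-- `inl x` is an endpoint of the split edge `e` iff `x` is an endpoint of `e` other than `u`
(no loop at `u`). -/
lemma inl_mem_splitEnds_iff (hloop : ∀ e, ends e ≠ s(u, u)) {e : E} {x : V} :
    Sum.inl x ∈ splitEnds ends u e ↔ x ∈ ends e ∧ x ≠ u := by
  by_cases he : u ∈ ends e
  · rw [splitEnds_of_mem he, Sym2.mem_iff]
    constructor
    · rintro (h | h)
      · have hx := Sum.inl.inj h
        subst hx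
        exact ⟨Sym2.other_mem he, other_ne_u hloop he⟩
      · exact absurd h Sum.inl_ne_inr
    · rintro ⟨hx, hxu⟩
      left
      congr 1
      rw [Sym2.mem_iff_exists] at hx
      obtain ⟨y, hy⟩ := hx
      have h1 : s(u, Sym2.Mem.other he) = s(x, y) := (Sym2.other_spec he).trans hy
      rw [Sym2.eq_iff] at h1
      rcases h1 with ⟨h, _⟩ | ⟨_, h⟩
      · exact absurd h.symm hxu
      · exact h.symm
  · rw [splitEnds_of_notMem he, Sym2.mem_map]
    constructor
    · rintro ⟨a, ha, hae⟩
      have := Sum.inl.inj hae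
      subst this
      exact ⟨ha, fun h => he (h ▸ ha)⟩
    · rintro ⟨hx, _⟩
      exact ⟨x, hx, rfl⟩

end Split

/-! ## Connectivity transfer between the graph and its split -/

section Transfer

variable {ends : E → Sym2 V} {u : V} {ω : Config E} {a : V}

omit [Fintype E] [DecidableEq E] in
/-- **From the split graph to the graph**: an `inl`-vertex connected to `inl a` is connected to
`a`, and a copy `inr e` connected to `inl a` is the copy of a red edge at `u` whose other end is
connected to `a`. -/
theorem cluster_split_subset :
    cluster (splitEnds ends u) ω (Sum.inl a) ⊆
      {v' | Sum.elim (fun x => Conn ends ω a x)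
        (fun e => ∃ h : u ∈ ends e, ω e = true ∧ Conn ends ω a (Sym2.Mem.other h)) v'} := by
  intro v' hv'
  refine mem_of_conn_of_closed (ends := splitEnds ends u) (ω := ω) ?_ (conn_refl ends ω a) hv'
  intro x' hx' y' hxy
  obtain ⟨hne, e, he, hends⟩ := openGraph_adj.1 hxy
  by_cases hu : u ∈ ends e
  · rw [splitEnds_of_mem hu, Sym2.eq_iff] at hends
    rcases hends with ⟨rfl, rfl⟩ | ⟨rfl, rfl⟩
    · exact ⟨hu, he, hx'⟩
    · obtain ⟨h', _, hc⟩ := hx'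
      exact hc
  · obtain ⟨p, q, hpq⟩ := exists_pair (ends e)
    rw [splitEnds_of_notMem hu, hpq, Sym2.map_mk, Sym2.eq_iff] at hends
    rcases hends with ⟨rfl, rfl⟩ | ⟨rfl, rfl⟩
    · exact mem_cluster_of_edge (v := a) hx' he hpq
    · exact mem_cluster_of_edge (v := a) hx' he (ends_swap hpq)

omit [Fintype E] [DecidableEq E] in
/-- `inl b` connected to `inl a` in the split graph gives `b` connected to `a`. -/
theorem conn_of_conn_split_inl {b : V}
    (h : Conn (splitEnds ends u) ω (Sum.inl a) (Sum.inl b)) : Conn ends ω a b :=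
  cluster_split_subset h

omit [Fintype E] [DecidableEq E] in
/-- A copy `inr e` connected to `inl a` in the split graph: `e` is a red edge at `u` whose other
end is connected to `a`. -/
theorem conn_of_conn_split_inr {e : E}
    (h : Conn (splitEnds ends u) ω (Sum.inl a) (Sum.inr e)) :
    ∃ hu : u ∈ ends e, ω e = true ∧ Conn ends ω a (Sym2.Mem.other hu) :=
  cluster_split_subset h

omit [Fintype E] [DecidableEq E] in
/-- **From the graph to the split graph**, away from `u`: if `u ∉ C(a)` then everything connected
to `a` is connected to `inl a` in the split graph. -/
theorem conn_split_of_conn (hu : u ∉ cluster ends ω a) {b : V} (hab : Conn ends ω a b) :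
    Conn (splitEnds ends u) ω (Sum.inl a) (Sum.inl b) := by
  refine mem_of_conn_of_closed (ends := ends) (ω := ω)
    (S := {x | Conn (splitEnds ends u) ω (Sum.inl a) (Sum.inl x)}) ?_ (conn_refl _ _ _) hab
  intro x hx y hxy
  obtain ⟨hne, e, he, hends⟩ := openGraph_adj.1 hxy
  have hxa : x ∈ cluster ends ω a := conn_of_conn_split_inl hx
  have hya : y ∈ cluster ends ω a := mem_cluster_of_edge hxa he hends
  have hxu : x ≠ u := fun h => hu (h ▸ hxa)
  have hyu : y ≠ u := fun h => hu (h ▸ hya)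
  exact mem_cluster_of_edge (v := Sum.inl a) hx he (splitEnds_eq_of_notMem hends hxu hyu)

omit [Fintype E] [DecidableEq E] in
/-- A copy `inr e` (edge `e` at `u`) lies in the split cluster of `inl a` iff `e` is red and its
other end's copy does. -/
theorem inr_mem_cluster_split_iff {e : E} (he : u ∈ ends e) :
    Sum.inr e ∈ cluster (splitEnds ends u) ω (Sum.inl a) ↔
      ω e = true ∧ Sum.inl (Sym2.Mem.other he) ∈ cluster (splitEnds ends u) ω (Sum.inl a) := by
  constructor
  · intro h
    have key : cluster (splitEnds ends u) ω (Sum.inl a) ⊆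
        {v' | v' ∈ cluster (splitEnds ends u) ω (Sum.inl a) ∧ (v' ≠ Sum.inr e ∨
          (ω e = true ∧ Sum.inl (Sym2.Mem.other he) ∈ cluster (splitEnds ends u) ω (Sum.inl a)))} := by
      intro v' hv'
      refine mem_of_conn_of_closed (ends := splitEnds ends u) (ω := ω) ?_
        ⟨mem_cluster_self _ _ _, Or.inl Sum.inl_ne_inr⟩ hv'
      intro x' hx' y' hxy
      obtain ⟨hne, e', he', hends⟩ := openGraph_adj.1 hxy
      refine ⟨mem_cluster_of_adj hx'.1 hxy, ?_⟩
      by_cases hy : y' = Sum.inr e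
      · subst hy
        have h1 : Sum.inr e ∈ splitEnds ends u e' := by
          rw [hends]; exact Sym2.mem_mk_right _ _
        obtain ⟨rfl, _⟩ := eq_of_inr_mem_splitEnds h1
        rw [splitEnds_of_mem he, Sym2.eq_iff] at hends
        rcases hends with ⟨rfl, _⟩ | ⟨h2, _⟩
        · exact Or.inr ⟨he', hx'.1⟩
        · exact absurd h2 Sum.inl_ne_inr
      · exact Or.inl hy
    rcases (key h).2 with h' | h'
    · exact absurd rfl h'
    · exact h'
  · rintro ⟨he', hc⟩
    exact mem_cluster_of_edge (v := Sum.inl a) hc he' (splitEnds_of_mem he)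

end Transfer


end LocRows

end Summit.Ventures.PercRepro2
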